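import Mathlib
import Literature.Probability.LatticeModels.ProdBernoulliIndependence
import Literature.Probability.Percolation.ConditionalPositiveAssociation
import Literature.Probability.Percolation.ConditionalPositiveAssociationProofs
import Literature.Probability.Percolation.TwoClusterConditionalAssociation
import Literature.Probability.Percolation.TwoClusterConditionalAssociationProofs
import Literature.Probability.Percolation.PercolationProofs
import Literature.Probability.Percolation.ClusterBoundary
import HarnessLib

/-!
# Crux `PercNearOneGluing.NearOneGluing` (stmt-CriticalPhenomena-4574), line `bhk-dyadic-thinning` — sub-goal `knLemma3i`

Helper file for the crux (lead prover-line-stmt-CriticalPhenomena-4574-0, wave 2): tooling / partial result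
for the residual `stub_doomWindow`.  Proves exactly the registered sub-goal signature; lands with
`--supports stmt-CriticalPhenomena-4574`.

## Content

Kozma–Nitzan, arXiv:2401.12397, **Lemma 3(i)** (p. 6), in denominator-free form on the finite
weighted graph `Fin n` (`μ = prodBernoulli w` on `Set (Sym2 (Fin n))`): if
`μ(a₁ ↔ b) ≤ μ(a₂ ↔ b) + d` with `d ≥ 0` and `Q` is increasing and determined by the open edge
cluster `C_{a₂}` of `a₂`, then `μ({a₁ ↔ b} ∩ Q) ≤ μ({a₂ ↔ b} ∩ Q) + d μ(Q)`.

Proof (KN pp. 6–7).  Put `D = {a₁ ↮ a₂}`.  Off `D` the events `{a₁ ↔ b}` and `{a₂ ↔ b}`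
coincide, so it suffices to compare the parts on `D`.  With `x_i = μ(D ∩ {a_i ↔ b})`,
`y_i = μ(D ∩ {a_i ↔ b} ∩ Q)`, `q = μ(D ∩ Q)`, `m = μ(D)`:
* van den Berg–Häggström–Kahn 2006, Thm. 1.3 (`s = a₂`, `X = {a₁}`, `f = 1{a₂ ↔ b}`, `g = 1_Q`,
  both increasing functions of `C_{a₂}`): `x₂ q ≤ m y₂`
  (`Literature.Probability.Percolation.BHK2006_clusterConditionalPositiveAssociation_holds`);
* BHK 2006, Thm. 1.4 (`s = a₁`, `t = a₂`, `f = 1{a₁ ↔ b}` a function of `C_{a₁}`, `g = 1_Q` a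
  function of `C_{a₂}`): `m y₁ ≤ x₁ q`
  (`Literature.Probability.Percolation.BHK2006_twoClusterConditionalAssociation_holds` and
  `.negCorrelation`);
* Harris (`Q` increasing, `D` decreasing): `q ≤ μ(Q) m`
  (`Literature.Probability.LatticeModels.prodBernoulli_harris_upper_lower`).
Hence `m y₁ ≤ x₁ q ≤ (x₂ + d) q ≤ m y₂ + d μ(Q) m`, and `y₁ ≤ y₂ + d μ(Q)` (trivially if `m = 0`).
-/

namespace Summit.CriticalPhenomena.PercolationContinuityZ3.Theorems

open scoped BigOperators Classical
open MeasureTheory Set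
open Literature.Probability.LatticeModels (prodBernoulli)
open Literature.Probability.Percolation (openConn openConnIn openCluster measurableSet_openConn_holds)

section KNLemma3i

open Literature.Probability.Percolation
open Literature.Probability.LatticeModels

universe u

variable {V : Type u}

/-- For `Q` increasing and determined by the open edge cluster `C_s`, the indicator of the
up-closure `S_Q = {C | ∃ ω ∈ Q, C_s ω ⊆ C}` evaluated at `C_s ω` is `1_Q ω`.
[cite: VandenbergHaggstromKahn2005, §1 p. 3 ("A is increasing and determined by the open cluster of s")] -/
theorem knLemma3i_indicator_upClosure_openEdgeCluster {Q : Set (BondConfig V)} {s : V}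
    (hQ : ∀ ω ω', ω ∈ Q → openEdgeCluster ω s ⊆ openEdgeCluster ω' s → ω' ∈ Q)
    (ω : BondConfig V) :
    {C : Set (Sym2 V) | ∃ ω' ∈ Q, openEdgeCluster ω' s ⊆ C}.indicator (1 : Set (Sym2 V) → ℝ)
        (openEdgeCluster ω s) = Q.indicator 1 ω := by
  by_cases hω : ω ∈ Q
  · have h1 : openEdgeCluster ω s ∈ {C : Set (Sym2 V) | ∃ ω' ∈ Q, openEdgeCluster ω' s ⊆ C} :=
      ⟨ω, hω, subset_rfl⟩
    rw [indicator_of_mem h1, indicator_of_mem hω, Pi.one_apply, Pi.one_apply]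
  · have h1 : openEdgeCluster ω s ∉ {C : Set (Sym2 V) | ∃ ω' ∈ Q, openEdgeCluster ω' s ⊆ C} := by
      rintro ⟨ω', hω', hsub⟩
      exact hω (hQ ω' ω hω' hsub)
    rw [indicator_of_notMem h1, indicator_of_notMem hω]

/-- The indicator of the up-closure `S_Q` is an increasing function of the set of edges.
[folklore] -/
theorem knLemma3i_monotone_indicator_upClosure (Q : Set (BondConfig V)) (s : V) :
    Monotone ({C : Set (Sym2 V) | ∃ ω ∈ Q, openEdgeCluster ω s ⊆ C}.indicator
      (1 : Set (Sym2 V) → ℝ)) := by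
  intro C C' hCC'
  by_cases h : C ∈ {C : Set (Sym2 V) | ∃ ω ∈ Q, openEdgeCluster ω s ⊆ C}
  · obtain ⟨ω, hω, hsub⟩ := h
    have h1 : C ∈ {C : Set (Sym2 V) | ∃ ω ∈ Q, openEdgeCluster ω s ⊆ C} := ⟨ω, hω, hsub⟩
    have h2 : C' ∈ {C : Set (Sym2 V) | ∃ ω ∈ Q, openEdgeCluster ω s ⊆ C} :=
      ⟨ω, hω, hsub.trans hCC'⟩
    rw [indicator_of_mem h1, indicator_of_mem h2, Pi.one_apply, Pi.one_apply]
  · rw [indicator_of_notMem h]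
    exact indicator_nonneg (fun _ _ => zero_le_one) _

variable [Fintype V]

/-- **BHK (2006) Thm. 1.3 with `f = 1{s ↔ b}`, `g = 1_Q`** (`Q` increasing and determined by
`C_s`, `X = {x}`): `μ(D ∩ {s↔b}) μ(D ∩ Q) ≤ μ(D) μ(D ∩ ({s↔b} ∩ Q))` for `D = {s ↮ x}`.
[cite: VandenbergHaggstromKahn2005, Thm. 1.3 (p. 6) and Thm. 1.2 (p. 5)] -/
theorem knLemma3i_oneCluster (w : Sym2 V → unitInterval) (s x b : V) (Q : Set (BondConfig V))
    (hQ : ∀ ω ω', ω ∈ Q → openEdgeCluster ω s ⊆ openEdgeCluster ω' s → ω' ∈ Q) (hsx : s ≠ x) :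
    (prodBernoulli w).real ((openConn s x)ᶜ ∩ openConn s b) *
        (prodBernoulli w).real ((openConn s x)ᶜ ∩ Q) ≤
      (prodBernoulli w).real (openConn s x)ᶜ *
        (prodBernoulli w).real ((openConn s x)ᶜ ∩ (openConn s b ∩ Q)) := by
  have key := BHK2006_clusterConditionalPositiveAssociation_holds V w s ({x} : Set V)
    (connIndicatorFn s b)
    ({C : Set (Sym2 V) | ∃ ω ∈ Q, openEdgeCluster ω s ⊆ C}.indicator (1 : Set (Sym2 V) → ℝ))
    (monotone_connIndicatorFn s b) (knLemma3i_monotone_indicator_upClosure Q s)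
    (fun h => hsx (Set.mem_singleton_iff.1 h))
  have hD : {ω : BondConfig V | ∀ y ∈ ({x} : Set V), ¬ (openGraph ω).Reachable s y} =
      (openConn s x)ᶜ := by
    ext ω
    simp only [Set.mem_setOf_eq, Set.mem_singleton_iff, forall_eq, Set.mem_compl_iff]
    rfl
  have hma : MeasurableSet (openConn s b : Set (BondConfig V)) := measurableSet_openConn_holds s b
  have hmQ : MeasurableSet Q := MeasurableSet.of_discrete
  simp only [connIndicatorFn_openEdgeCluster, knLemma3i_indicator_upClosure_openEdgeCluster hQ,
    hD] at key
  rw [show (fun ω : BondConfig V => (openConn s b).indicator (1 : BondConfig V → ℝ) ω *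
        Q.indicator 1 ω) = (openConn s b ∩ Q).indicator 1 from
      funext fun ω => (congrFun (Set.inter_indicator_one (s := openConn s b)
        (t := Q) (M₀ := ℝ)) ω).symm] at key
  rw [setIntegral_indicator (hma.inter hmQ), setIntegral_indicator hma, setIntegral_indicator hmQ]
    at key
  simpa only [Pi.one_apply, setIntegral_const, smul_eq_mul, mul_one] using key

/-- **BHK (2006) Thm. 1.4 with `f = 1{s ↔ b}`, `g = 1_Q`** (`Q` increasing and determined by
`C_t`): `μ(D) μ(D ∩ ({s↔b} ∩ Q)) ≤ μ(D ∩ {s↔b}) μ(D ∩ Q)` for `D = {s ↮ t}`.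
[cite: VandenbergHaggstromKahn2005, Thm. 1.4 (p. 7) and eq. (2) (p. 2)] -/
theorem knLemma3i_twoCluster (w : Sym2 V → unitInterval) (s t b : V)
    (Q : Set (BondConfig V))
    (hQ : ∀ ω ω', ω ∈ Q → openEdgeCluster ω t ⊆ openEdgeCluster ω' t → ω' ∈ Q) (hst : s ≠ t) :
    (prodBernoulli w).real (openConn s t)ᶜ *
        (prodBernoulli w).real ((openConn s t)ᶜ ∩ (openConn s b ∩ Q)) ≤
      (prodBernoulli w).real ((openConn s t)ᶜ ∩ openConn s b) *
        (prodBernoulli w).real ((openConn s t)ᶜ ∩ Q) := by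
  have key := BHK2006_twoClusterConditionalAssociation.negCorrelation
    BHK2006_twoClusterConditionalAssociation_holds V w s t (connIndicatorFn s b)
    ({C : Set (Sym2 V) | ∃ ω ∈ Q, openEdgeCluster ω t ⊆ C}.indicator (1 : Set (Sym2 V) → ℝ))
    (monotone_connIndicatorFn s b) (knLemma3i_monotone_indicator_upClosure Q t) hst
  have hD : {ω : BondConfig V | ¬ (openGraph ω).Reachable s t} = (openConn s t)ᶜ := rfl
  have hma : MeasurableSet (openConn s b : Set (BondConfig V)) := measurableSet_openConn_holds s b
  have hmQ : MeasurableSet Q := MeasurableSet.of_discrete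
  simp only [connIndicatorFn_openEdgeCluster, knLemma3i_indicator_upClosure_openEdgeCluster hQ,
    hD] at key
  rw [show (fun ω : BondConfig V => (openConn s b).indicator (1 : BondConfig V → ℝ) ω *
        Q.indicator 1 ω) = (openConn s b ∩ Q).indicator 1 from
      funext fun ω => (congrFun (Set.inter_indicator_one (s := openConn s b)
        (t := Q) (M₀ := ℝ)) ω).symm] at key
  rw [setIntegral_indicator (hma.inter hmQ), setIntegral_indicator hma, setIntegral_indicator hmQ]
    at key
  simpa only [Pi.one_apply, setIntegral_const, smul_eq_mul, mul_one] using key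

end KNLemma3i

open Literature.Probability.Percolation in
/-- Kozma–Nitzan arXiv:2401.12397 Lemma 3(i) (p. 6), denominator-free: if `P(a₁↔b) ≤ P(a₂↔b) + d` and `Q` is increasing and determined by the open edge cluster of `a₂`, then `P(a₁↔b, Q) ≤ P(a₂↔b, Q) + d·P(Q)`. From BHK 2006 Thm 1.3 and Thm 1.4 (both proved in the tree). [cite: KozmaNitzan2024, Lemma 3(i)] -/
theorem knLemma3i :
    ∀ (n : ℕ) (w : Sym2 (Fin n) → unitInterval) (a₁ a₂ b : Fin n)
      (Q : Set (Literature.Probability.Percolation.BondConfig (Fin n))) (d : ℝ),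
      (∀ ω ω', ω ∈ Q → Literature.Probability.Percolation.openEdgeCluster ω a₂ ⊆
          Literature.Probability.Percolation.openEdgeCluster ω' a₂ → ω' ∈ Q) →
      0 ≤ d →
      (Literature.Probability.LatticeModels.prodBernoulli w).real
          (Literature.Probability.Percolation.openConn a₁ b) ≤
        (Literature.Probability.LatticeModels.prodBernoulli w).real
          (Literature.Probability.Percolation.openConn a₂ b) + d →
      (Literature.Probability.LatticeModels.prodBernoulli w).real
          (Literature.Probability.Percolation.openConn a₁ b ∩ Q) ≤
        (Literature.Probability.LatticeModels.prodBernoulli w).real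
          (Literature.Probability.Percolation.openConn a₂ b ∩ Q) +
          d * (Literature.Probability.LatticeModels.prodBernoulli w).real Q := by
  intro n w a₁ a₂ b Q d hQ hd hle
  rcases eq_or_ne a₁ a₂ with h12 | h12
  · subst h12
    exact le_add_of_nonneg_right (mul_nonneg hd measureReal_nonneg)
  -- `D = {a₁ ↮ a₂} = (openConn a₁ a₂)ᶜ`
  have hDm : MeasurableSet ((openConn a₁ a₂)ᶜ : Set (BondConfig (Fin n))) :=
    MeasurableSet.of_discrete
  -- (1) on `{a₁ ↔ a₂}` the events `{a₁ ↔ b}` and `{a₂ ↔ b}` coincide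
  have hagree : ∀ E : Set (BondConfig (Fin n)),
      (openConn a₁ b ∩ E) \ (openConn a₁ a₂)ᶜ = (openConn a₂ b ∩ E) \ (openConn a₁ a₂)ᶜ := by
    intro E
    ext ω
    simp only [Set.mem_sdiff, Set.mem_inter_iff, Set.mem_compl_iff, not_not]
    constructor
    · rintro ⟨⟨h1, hE⟩, h2⟩
      exact ⟨⟨SimpleGraph.Reachable.trans (SimpleGraph.Reachable.symm h2) h1, hE⟩, h2⟩
    · rintro ⟨⟨h1, hE⟩, h2⟩
      exact ⟨⟨SimpleGraph.Reachable.trans h2 h1, hE⟩, h2⟩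
  have hs1 := measureReal_inter_add_sdiff (μ := prodBernoulli w) (s := openConn a₁ b) hDm
  have hs2 := measureReal_inter_add_sdiff (μ := prodBernoulli w) (s := openConn a₂ b) hDm
  have hs1Q := measureReal_inter_add_sdiff (μ := prodBernoulli w) (s := openConn a₁ b ∩ Q) hDm
  have hs2Q := measureReal_inter_add_sdiff (μ := prodBernoulli w) (s := openConn a₂ b ∩ Q) hDm
  have he : (prodBernoulli w).real (openConn a₁ b \ (openConn a₁ a₂)ᶜ) =
      (prodBernoulli w).real (openConn a₂ b \ (openConn a₁ a₂)ᶜ) := by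
    have h := hagree Set.univ
    simp only [Set.inter_univ] at h
    rw [h]
  have heQ : (prodBernoulli w).real ((openConn a₁ b ∩ Q) \ (openConn a₁ a₂)ᶜ) =
      (prodBernoulli w).real ((openConn a₂ b ∩ Q) \ (openConn a₁ a₂)ᶜ) := by
    rw [hagree Q]
  rw [Set.inter_comm (openConn a₁ b) (openConn a₁ a₂)ᶜ] at hs1
  rw [Set.inter_comm (openConn a₂ b) (openConn a₁ a₂)ᶜ] at hs2
  rw [Set.inter_comm (openConn a₁ b ∩ Q) (openConn a₁ a₂)ᶜ] at hs1Q
  rw [Set.inter_comm (openConn a₂ b ∩ Q) (openConn a₁ a₂)ᶜ] at hs2Q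
  -- (2) BHK Thm. 1.3 (`s = a₂`, `X = {a₁}`) and (3) BHK Thm. 1.4 (`s = a₁`, `t = a₂`)
  have hI := knLemma3i_oneCluster w a₂ a₁ b Q hQ h12.symm
  have hcomm : (openConn a₂ a₁ : Set (BondConfig (Fin n))) = openConn a₁ a₂ :=
    Set.ext fun _ => ⟨fun h => SimpleGraph.Reachable.symm h, fun h => SimpleGraph.Reachable.symm h⟩
  rw [hcomm] at hI
  have hII := knLemma3i_twoCluster w a₁ a₂ b Q hQ h12
  -- Harris: `Q` increasing, `D` decreasing
  have hQu : IsUpperSet Q := fun ω ω' hωω' hω =>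
    hQ ω ω' hω (BHK2006.openEdgeCluster_mono hωω' a₂)
  have hDl : IsLowerSet ((openConn a₁ a₂)ᶜ : Set (BondConfig (Fin n))) :=
    (isUpperSet_openConn a₁ a₂).compl
  have hH := Literature.Probability.LatticeModels.prodBernoulli_harris_upper_lower w hQu hDl
    MeasurableSet.of_discrete hDm
  rw [Set.inter_comm Q (openConn a₁ a₂)ᶜ] at hH
  -- (4) combine
  have hx : (prodBernoulli w).real ((openConn a₁ a₂)ᶜ ∩ openConn a₁ b) ≤
      (prodBernoulli w).real ((openConn a₁ a₂)ᶜ ∩ openConn a₂ b) + d := by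
    linarith
  have hfin : (prodBernoulli w).real ((openConn a₁ a₂)ᶜ ∩ (openConn a₁ b ∩ Q)) ≤
      (prodBernoulli w).real ((openConn a₁ a₂)ᶜ ∩ (openConn a₂ b ∩ Q)) +
        d * (prodBernoulli w).real Q := by
    rcases eq_or_lt_of_le (measureReal_nonneg :
        0 ≤ (prodBernoulli w).real ((openConn a₁ a₂)ᶜ : Set (BondConfig (Fin n)))) with hm0 | hmpos
    · have hy1 : (prodBernoulli w).real ((openConn a₁ a₂)ᶜ ∩ (openConn a₁ b ∩ Q)) = 0 :=
        measureReal_mono_null Set.inter_subset_left hm0.symm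
      rw [hy1]
      exact add_nonneg measureReal_nonneg (mul_nonneg hd measureReal_nonneg)
    · refine le_of_mul_le_mul_left ?_ hmpos
      calc (prodBernoulli w).real (openConn a₁ a₂)ᶜ *
            (prodBernoulli w).real ((openConn a₁ a₂)ᶜ ∩ (openConn a₁ b ∩ Q))
          ≤ (prodBernoulli w).real ((openConn a₁ a₂)ᶜ ∩ openConn a₁ b) *
            (prodBernoulli w).real ((openConn a₁ a₂)ᶜ ∩ Q) := hII
        _ ≤ ((prodBernoulli w).real ((openConn a₁ a₂)ᶜ ∩ openConn a₂ b) + d) *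
            (prodBernoulli w).real ((openConn a₁ a₂)ᶜ ∩ Q) :=
          mul_le_mul_of_nonneg_right hx measureReal_nonneg
        _ = (prodBernoulli w).real ((openConn a₁ a₂)ᶜ ∩ openConn a₂ b) *
              (prodBernoulli w).real ((openConn a₁ a₂)ᶜ ∩ Q) +
            d * (prodBernoulli w).real ((openConn a₁ a₂)ᶜ ∩ Q) := add_mul _ _ _
        _ ≤ (prodBernoulli w).real (openConn a₁ a₂)ᶜ *
              (prodBernoulli w).real ((openConn a₁ a₂)ᶜ ∩ (openConn a₂ b ∩ Q)) +
            d * ((prodBernoulli w).real Q * (prodBernoulli w).real (openConn a₁ a₂)ᶜ) :=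
          add_le_add hI (mul_le_mul_of_nonneg_left hH hd)
        _ = (prodBernoulli w).real (openConn a₁ a₂)ᶜ *
            ((prodBernoulli w).real ((openConn a₁ a₂)ᶜ ∩ (openConn a₂ b ∩ Q)) +
              d * (prodBernoulli w).real Q) := by ring
  linarith

end Summit.CriticalPhenomena.PercolationContinuityZ3.Theorems
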